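import Summits.Schanuel.Schanuel.Theorems.RootDecomp1KOnePointCell03

/-!
# RootDecomp1KOnePointCell — lens 1, generation 39 «ONE-POINT ZERO ESTIMATE + LOG-LOG WALL CELL of 33364» ((1, ℓ₂, ℓ₃, ρ) for every log-log-Liouville ρ) — continuation (RootDecomp1KOnePointCell04): §3b the general form over two bases: `MulIndep`, `onePoint_nonvanishing_general` (`maxHeartbeats 800000`), the `(3,2)` / `(2,3)` instances

(lens-1 g39 `RootDecomp1KOnePointCell.lean` [HOME/decomp-schanuel-lens-1/g39/RootDecomp1KOnePointCell.lean sha256 4a1f4bc8…4211, 2530 l + OPprobe + OPctrl + NODE-g39.md; NOTE/CLAIM L1801, ACK + CHECKLIST K-g39 L1803, presearch (6) resolved by the critic L1810, NODE L1824 / REQUEST L1825 / RESULT L1826]; port by census-1 gen 16 in ten parts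
`RootDecomp1KOnePointCell01`–`10` — see the PORT NOTE of part 01; `--supports stmt-Schanuel-33364`; rung 0.)
-/

open Complex IntermediateField Polynomial
open Summit.Schanuel.Schanuel.Theorems.RootDecomp1KHyper
open Summit.Schanuel.Schanuel.Theorems.RootDecomp1KHyper.HyperCell
open Summit.Schanuel.Schanuel.Theorems.RootDecomp1KGeneric
open Summit.Schanuel.Schanuel.Theorems.RootDecomp1KRelLiouvilleCell
open Summit.Schanuel.Schanuel.Theorems.RootDecomp1KLogLogCell
open Summit.Schanuel.Schanuel.Theorems.RootDecomp1KTwoBaseCell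
open Summit.Schanuel.Schanuel.Theorems.RootDecomp1KMeasuredWallCell

namespace Summit.Schanuel.Schanuel.Theorems.RootDecomp1KOnePointCell

section OnePoint
open LiouvilleNumber
open scoped Nat

/-! ### §3b  THE GENERAL FORM over two bases `(b, c)`: multiplicative independence is the ONLY base input -/

/-- **Multiplicative independence of two bases** (the NAMED hypothesis of the general one-point estimate):
`(i, j) ↦ b^i c^j` is injective on `ℕ × ℕ` — equivalently, `b` and `c` are not both powers of one integer.
It HOLDS for `(3, 2)` (unique factorisation, `mulIndep_three_two`) and FAILS for `(2, 4)`, `(4, 2)`, `(2, 8)`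
(`2²·4⁰ = 2⁰·4¹`): the common-radix blocks `(ℓ₂, ℓ₄)`, `(ℓ₂, ℓ₈)` are VISIBLY OUTSIDE the estimate. -/
def MulIndep (b c : ℕ) : Prop := ∀ i j i' j' : ℕ, b ^ i * c ^ j = b ^ i' * c ^ j' → i = i' ∧ j = j'

/-- `(3, 2)` is multiplicatively independent — by unique factorisation (the 2-adic valuation reads off `j`,
then `3^i` determines `i`). -/
theorem mulIndep_three_two : MulIndep 3 2 := by
  intro i j i' j' h
  have hv : ∀ x y : ℕ, padicValNat 2 (3 ^ x * 2 ^ y) = y := by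
    intro x y
    have hodd : ¬ 2 ∣ 3 ^ x := by
      rw [Nat.two_dvd_ne_zero]; exact Nat.odd_iff.mp (Odd.pow (Nat.odd_iff.mpr (by norm_num)))
    rw [padicValNat.mul (pow_ne_zero _ (by norm_num)) (pow_ne_zero _ (by norm_num)),
      padicValNat.eq_zero_of_not_dvd hodd, padicValNat.prime_pow, zero_add]
  have hjj : j = j' := by
    have h1 := hv i j
    rw [h, hv] at h1
    exact h1.symm
  rw [hjj] at h
  have h3 : 3 ^ i = 3 ^ i' := Nat.eq_of_mul_eq_mul_right (by positivity) h
  exact ⟨Nat.pow_right_injective (by norm_num : 2 ≤ 3) h3, hjj⟩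

/-- Symmetry of multiplicative independence. -/
theorem MulIndep.symm {b c : ℕ} (h : MulIndep b c) : MulIndep c b := fun i j i' j' e =>
  let r := h j i j' i' (by rw [mul_comm, e, mul_comm])
  ⟨r.2, r.1⟩

/-- `(2, 3)` is multiplicatively independent. -/
theorem mulIndep_two_three : MulIndep 2 3 := mulIndep_three_two.symm

/-- **NON-instance:** `(2, 4)` is NOT multiplicatively independent (`2² · 4⁰ = 2⁰ · 4¹`) — the common-radix
block `(ℓ₂, ℓ₄)` is outside the general estimate (honest scope, (β″)). -/
theorem not_mulIndep_two_four : ¬ MulIndep 2 4 := fun h => by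
  have := (h 2 0 0 1 (by norm_num)).1
  omega

/-- **NON-instance:** `(4, 2)` is NOT multiplicatively independent. -/
theorem not_mulIndep_four_two : ¬ MulIndep 4 2 := fun h => not_mulIndep_two_four h.symm

/-- **NON-instance:** `(2, 8)` is NOT multiplicatively independent (`2³ = 8`). -/
theorem not_mulIndep_two_eight : ¬ MulIndep 2 8 := fun h => by
  have := (h 3 0 0 1 (by norm_num)).1
  omega

/-- **NON-instance:** a base is never independent of itself (`b¹·b⁰ = b⁰·b¹`). -/
theorem not_mulIndep_self (b : ℕ) : ¬ MulIndep b b := fun h => by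
  have := (h 1 0 0 1 (by ring)).1
  omega

/-- `psNumer b K < 2 · b^{K!}` for every base `b ≥ 2` (`s^b_K < ℓ_b ≤ 3/2 < 2`). -/
theorem psNumer_lt_two_mul {b : ℕ} (hb : 2 ≤ b) (K : ℕ) : (psNumer b K : ℤ) < 2 * (b : ℤ) ^ K ! := by
  have hb1 : (1 : ℝ) < (b : ℝ) := by exact_mod_cast (show 1 < b by omega)
  have h1 : ((psQ b K : ℚ) : ℝ) < 2 := by
    rw [psQ_cast]
    have := (partialSum_pos_lt hb1 K).2
    have hle : liouvilleNumber (b : ℝ) ≤ 3 / 2 := liouvilleNumber_le (by exact_mod_cast hb)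
    linarith
  have h2 : (psQ b K : ℚ) < 2 := by exact_mod_cast h1
  rw [psQ_eq_div (by omega)] at h2
  have h3 : (0 : ℚ) < ((b : ℕ) : ℚ) ^ K ! := by positivity
  rw [div_lt_iff₀ h3] at h2
  exact_mod_cast h2

/-- The arithmetic ending of the general estimate. -/
theorem final_count_gen {K' d m q lam : ℕ} (hK : 12 * lam * m * (d + 1) ≤ K' + 1) (hm1 : 1 ≤ m)
    (hq1 : 1 ≤ q) (hlam : 4 ≤ lam)
    (hexp : 2 * (K' * q) ≤ 2 * (8 * d + 2 * d * (lam * (m * q))) + (K' + 1) * q) : False := by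
  have hKq : 12 * lam * m * (d + 1) * q ≤ (K' + 1) * q := Nat.mul_le_mul_right q hK
  have hmq : q ≤ m * q := Nat.le_mul_of_pos_left q hm1
  have hdq : d ≤ d * (m * q) := Nat.le_mul_of_pos_right d (Nat.mul_pos hm1 hq1)
  have hl1 : 4 * (d * (m * q)) ≤ lam * (d * (m * q)) := Nat.mul_le_mul_right _ hlam
  have hl2 : 4 * (m * q) ≤ lam * (m * q) := Nat.mul_le_mul_right _ hlam
  nlinarith

set_option maxHeartbeats 800000 in
/-- **(T_gen) THE ONE-POINT ZERO ESTIMATE FOR TWO MULTIPLICATIVELY INDEPENDENT BASES.** For bases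
`b, c ≥ 2` with `MulIndep b c` (NAMED hypothesis — the ONLY base-specific input), a non-zero `F ∈ ℤ[x][y]` of
partial degrees `≤ d` and height `≤ L` does NOT vanish at the one point `(x, y) = (s^b_K, s^c_K)`
(`psQ b K`, `psQ c K`: the `K`-th truncations of `ℓ_b`, `ℓ_c`) as soon as `K ≥ 12 (bc)^{d+1} (d+1)` and
`L^{2 (bc)^d} ≤ 2^{K!}`.  Same mechanism as (T): re-centre at the previous truncation after the integer
rescaling `x ↦ b^{N'} x`, `y ↦ c^{N'} y`; the weights `b^{d−a} c^{d−b'}` are pairwise distinct EXACTLY by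
`MulIndep b c`; dominance; counting.  At `(b, c) = (3, 2)` the hypothesis is discharged by
`mulIndep_three_two`; at `(2, 4)`, `(4, 2)`, `(2, 8)` it is FALSE (`not_mulIndep_two_four`, …) and the theorem
says nothing (honestly: equal weights can cancel — the E-side input (β″) would be needed there). -/
theorem onePoint_nonvanishing_general {b c : ℕ} (hb : 2 ≤ b) (hc : 2 ≤ c) (hind : MulIndep b c)
    (F : ℤ[X][X]) (hF : F ≠ 0) {d K : ℕ} {L : ℤ}
    (hdegy : F.natDegree ≤ d) (hdegx : ∀ i, (F.coeff i).natDegree ≤ d)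
    (hcoef : ∀ i j, |(F.coeff i).coeff j| ≤ L)
    (hK : 12 * (b * c) ^ (d + 1) * (d + 1) ≤ K) (hL : L ^ (2 * (b * c) ^ d) ≤ (2 : ℤ) ^ K !) :
    evxy (psQ b K) (psQ c K) F ≠ 0 := by
  classical
  intro hzero
  have hL0 : 0 ≤ L := (abs_nonneg _).trans (hcoef 0 0)
  have hb0 : b ≠ 0 := by omega
  have hc0 : c ≠ 0 := by omega
  have hbpos : 0 < b := by omega
  have hcpos : 0 < c := by omega
  have hbQ : (b : ℚ) ≠ 0 := by exact_mod_cast hb0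
  have hcQ : (c : ℚ) ≠ 0 := by exact_mod_cast hc0
  -- the scales: K = K' + 1, N' = K'!, M = K'·K'!, m = (bc)^d ∣ N' = m q, lam = bc
  set lam : ℕ := b * c with hlamdef
  have hlam4 : 4 ≤ lam := by rw [hlamdef]; nlinarith
  set m : ℕ := lam ^ d with hmdef
  have hm1 : 1 ≤ m := Nat.one_le_pow _ _ (by omega)
  have hm0 : m ≠ 0 := by omega
  have h12 : 12 * lam ^ (d + 1) = 12 * lam * m := by rw [hmdef, pow_succ]; ring
  rw [h12] at hK
  have h48m : 48 * m ≤ 12 * lam * m * (d + 1) := by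
    have : 12 * lam * m ≤ 12 * lam * m * (d + 1) := Nat.le_mul_of_pos_right _ (by omega)
    nlinarith
  obtain ⟨K', rfl⟩ : ∃ K', K = K' + 1 := ⟨K - 1, by omega⟩
  set N' : ℕ := K' ! with hN'def
  have hN'pos : 0 < N' := Nat.factorial_pos K'
  set M : ℕ := K' * N' with hMdef
  have hK'1 : 1 ≤ K' := by omega
  have hM1 : 1 ≤ M := Nat.mul_pos (by omega) hN'pos
  have hfact : (K' + 1)! = M + N' := by rw [hMdef, hN'def, Nat.factorial_succ]; ring
  have hmK' : m ≤ K' := by omega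
  obtain ⟨q, hq⟩ : m ∣ N' := Nat.dvd_factorial hm1 hmK'
  have hq1 : 1 ≤ q := by
    rcases Nat.eq_zero_or_pos q with h | h
    · exfalso; rw [h, mul_zero] at hq; omega
    · exact h
  have hmM : m ∣ M := ⟨K' * q, by rw [hMdef, hq]; ring⟩
  have hMm : M / m = K' * q := by
    rw [hMdef, hq, show K' * (m * q) = m * (K' * q) by ring, Nat.mul_div_cancel_left _ (by omega)]
  -- the integer data: s = b^{N'}, t = c^{N'}, centre (A, B) = (psNumer b K', psNumer c K')
  set s : ℤ := (b : ℤ) ^ N' with hsdef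
  set t : ℤ := (c : ℤ) ^ N' with htdef
  have hb1Z : (1 : ℤ) ≤ b := by exact_mod_cast hbpos
  have hc1Z : (1 : ℤ) ≤ c := by exact_mod_cast hcpos
  have hs1 : 1 ≤ s := one_le_pow₀ hb1Z
  have ht1 : 1 ≤ t := one_le_pow₀ hc1Z
  have hs0 : 0 ≤ s := by linarith
  have ht0 : 0 ≤ t := by linarith
  set A : ℤ := (psNumer b K' : ℤ) with hAdef
  set B : ℤ := (psNumer c K' : ℤ) with hBdef
  have hA : |A| ≤ 2 * s := by
    rw [abs_of_nonneg (by positivity), hAdef, hsdef]; exact (psNumer_lt_two_mul hb K').le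
  have hB : |B| ≤ 2 * t := by
    rw [abs_of_nonneg (by positivity), hBdef, htdef]; exact (psNumer_lt_two_mul hc K').le
  have h2s1 : 1 ≤ 2 * s := by linarith
  have h2t1 : 1 ≤ 2 * t := by linarith
  -- the evaluation point after rescaling: (s·s^b_K, t·s^c_K) = (A + b^{−M}, B + c^{−M})
  set u : ℚ := 1 / (b : ℚ) ^ M with hudef
  set v : ℚ := 1 / (c : ℚ) ^ M with hvdef
  have hx : (s : ℚ) * psQ b (K' + 1) = u + A := by
    rw [psQ_succ, psQ_eq_div hbpos, hfact, hsdef, hAdef, hudef]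
    push_cast
    field_simp
    ring
  have hy : (t : ℚ) * psQ c (K' + 1) = v + B := by
    rw [psQ_succ, psQ_eq_div hcpos, hfact, htdef, hBdef, hvdef]
    push_cast
    field_simp
    ring
  -- the rescaled-and-shifted polynomial G ∈ ℤ[X][Y]: non-zero, degrees ≤ d, height ≤ Bnd
  set Fs : ℤ[X][X] := scaleXY F s t d with hFsdef
  set G : ℤ[X][X] := shiftXY Fs A B with hGdef
  have hFs0 : Fs ≠ 0 := scaleXY_ne_zero F hF (by positivity) (by positivity) hdegy hdegx
  have hG0 : G ≠ 0 := shiftXY_ne_zero Fs hFs0 A B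
  have hGdegy : G.natDegree ≤ d := natDegree_shiftXY_le Fs A B (natDegree_scaleXY_le F s t d)
  have hGdegx : ∀ b', (G.coeff b').natDegree ≤ d :=
    natDegree_coeff_shiftXY_le Fs A B (natDegree_coeff_scaleXY_le F s t d)
  set Bnd : ℤ := (d + 1) * 2 ^ d * (2 * s) ^ d * ((d + 1) * 2 ^ d * (2 * t) ^ d * (L * s ^ d * t ^ d))
    with hBnddef
  have hGcoef : ∀ b' a, |(G.coeff b').coeff a| ≤ Bnd := fun b' a =>
    abs_coeff_coeff_shiftXY_le Fs (natDegree_scaleXY_le F s t d) (natDegree_coeff_scaleXY_le F s t d)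
      (abs_coeff_coeff_scaleXY_le F hs1 ht1 d hcoef) hA h2s1 hB h2t1 b' a
  -- G(b^{−M}, c^{−M}) = s^d t^d F(s^b_K, s^c_K) = 0
  have hGuv : evxy u v G = 0 := by
    rw [hGdef, evxy_shiftXY, ← hx, ← hy, hFsdef, evxy_scaleXY F s t hdegy hdegx, hzero, mul_zero]
  rw [evxy_eq_sum_sum u v G hGdegy hGdegx] at hGuv
  -- cleared of denominators: Σ_{b',a ≤ d} G_{b'a} (b^{d−a} c^{d−b'})^M = 0 over ℤ
  have hZsum : ∑ b' ∈ Finset.range (d + 1), ∑ a ∈ Finset.range (d + 1),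
      (G.coeff b').coeff a * (((b ^ (d - a) * c ^ (d - b') : ℕ) : ℤ)) ^ M = 0 := by
    have h3 : (b : ℚ) ^ M ≠ 0 := pow_ne_zero _ hbQ
    have h2 : (c : ℚ) ^ M ≠ 0 := pow_ne_zero _ hcQ
    have key : ∀ b' ∈ Finset.range (d + 1), ∀ a ∈ Finset.range (d + 1),
        (((G.coeff b').coeff a : ℤ) : ℚ) * u ^ a * v ^ b' * ((b : ℚ) ^ (d * M) * (c : ℚ) ^ (d * M)) =
          (((G.coeff b').coeff a * (((b ^ (d - a) * c ^ (d - b') : ℕ) : ℤ)) ^ M : ℤ) : ℚ) := by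
      intro b' hb' a ha
      have ha' : a ≤ d := by have := Finset.mem_range.mp ha; omega
      have hb'' : b' ≤ d := by have := Finset.mem_range.mp hb'; omega
      have hsplit3 : d * M = (d - a) * M + M * a := by
        rw [mul_comm M a, ← Nat.add_mul, Nat.sub_add_cancel ha']
      have hsplit2 : d * M = (d - b') * M + M * b' := by
        rw [mul_comm M b', ← Nat.add_mul, Nat.sub_add_cancel hb'']
      have e3 : (b : ℚ) ^ (d * M) * u ^ a = (b : ℚ) ^ ((d - a) * M) := by
        rw [hudef, hsplit3, pow_add, pow_mul (b : ℚ) M a, mul_assoc, ← mul_pow, mul_one_div_cancel h3,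
          one_pow, mul_one]
      have e2 : (c : ℚ) ^ (d * M) * v ^ b' = (c : ℚ) ^ ((d - b') * M) := by
        rw [hvdef, hsplit2, pow_add, pow_mul (c : ℚ) M b', mul_assoc, ← mul_pow, mul_one_div_cancel h2,
          one_pow, mul_one]
      rw [show (((G.coeff b').coeff a * (((b ^ (d - a) * c ^ (d - b') : ℕ) : ℤ)) ^ M : ℤ) : ℚ) =
          (((G.coeff b').coeff a : ℤ) : ℚ) * ((b : ℚ) ^ ((d - a) * M) * (c : ℚ) ^ ((d - b') * M)) by
        push_cast; rw [mul_pow, ← pow_mul, ← pow_mul], ← e3, ← e2]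
      ring
    have hsumQ : (∑ b' ∈ Finset.range (d + 1), ∑ a ∈ Finset.range (d + 1),
        (((G.coeff b').coeff a : ℤ) : ℚ) * u ^ a * v ^ b') * ((b : ℚ) ^ (d * M) * (c : ℚ) ^ (d * M)) = 0 := by
      rw [hGuv, zero_mul]
    rw [Finset.sum_mul] at hsumQ
    simp_rw [Finset.sum_mul] at hsumQ
    rw [Finset.sum_congr rfl (fun b' hb' => Finset.sum_congr rfl (fun a ha => key b' hb' a ha))] at hsumQ
    exact_mod_cast hsumQ
  -- the box as a product finset; DOMINANCE (distinct weights = MulIndep)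
  set S : Finset (ℕ × ℕ) := Finset.range (d + 1) ×ˢ Finset.range (d + 1) with hSdef
  have hZsum' : ∑ p ∈ S, (G.coeff p.1).coeff p.2 * (((b ^ (d - p.2) * c ^ (d - p.1) : ℕ) : ℤ)) ^ M = 0 := by
    rw [hSdef, Finset.sum_product]; exact hZsum
  have he1 : ∀ p ∈ S, 1 ≤ b ^ (d - p.2) * c ^ (d - p.1) := fun p _ =>
    Nat.one_le_iff_ne_zero.mpr (Nat.mul_ne_zero (pow_ne_zero _ hb0) (pow_ne_zero _ hc0))
  have hem : ∀ p ∈ S, b ^ (d - p.2) * c ^ (d - p.1) ≤ m := by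
    intro p _
    have h6 : m = b ^ d * c ^ d := by rw [hmdef, hlamdef, mul_pow]
    rw [h6]
    exact Nat.mul_le_mul (Nat.pow_le_pow_right hbpos (Nat.sub_le _ _))
      (Nat.pow_le_pow_right hcpos (Nat.sub_le _ _))
  have hinj : ∀ p ∈ S, ∀ p' ∈ S,
      b ^ (d - p.2) * c ^ (d - p.1) = b ^ (d - p'.2) * c ^ (d - p'.1) → p = p' := by
    intro p hp p' hp' h
    obtain ⟨hb', ha⟩ := Finset.mem_product.mp hp
    obtain ⟨hb'', ha'⟩ := Finset.mem_product.mp hp'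
    rw [Finset.mem_range] at ha hb' ha' hb''
    obtain ⟨h1, h2⟩ := hind _ _ _ _ h
    exact Prod.ext (by omega) (by omega)
  have hZ : ∀ p ∈ S, |(G.coeff p.1).coeff p.2| ≤ Bnd := fun p _ => hGcoef p.1 p.2
  have hne : ∃ p ∈ S, (G.coeff p.1).coeff p.2 ≠ 0 := by
    have hGb : G.coeff G.natDegree ≠ 0 := by
      have := Polynomial.leadingCoeff_ne_zero.mpr hG0
      rwa [Polynomial.leadingCoeff] at this
    have hGba : (G.coeff G.natDegree).coeff (G.coeff G.natDegree).natDegree ≠ 0 := by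
      have := Polynomial.leadingCoeff_ne_zero.mpr hGb
      rwa [Polynomial.leadingCoeff] at this
    refine ⟨(G.natDegree, (G.coeff G.natDegree).natDegree), ?_, hGba⟩
    rw [hSdef, Finset.mem_product, Finset.mem_range, Finset.mem_range]
    exact ⟨Nat.lt_succ_of_le hGdegy, Nat.lt_succ_of_le (hGdegx _)⟩
  have hdom := dominance S (fun p => (G.coeff p.1).coeff p.2)
    (fun p => b ^ (d - p.2) * c ^ (d - p.1)) (m := m) (M := M) (B := Bnd)
    hM1 he1 hem hinj hZ hne hZsum'
  have hdom2 : (2 : ℤ) ^ (K' * q) ≤ (S.card : ℤ) * Bnd := by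
    rw [← hMm]; exact two_pow_le_of_dominance hm1 hmM hdom
  have hcard : S.card = (d + 1) * (d + 1) := by
    rw [hSdef, Finset.card_product, Finset.card_range]
  rw [hcard] at hdom2
  push_cast at hdom2
  -- the final count: 2^{K' q} ≤ (d+1)^4 16^d (st)^{2d} · L =: W · L, W ≤ 2^{8d + 2d·lam·N'}, L² ≤ 2^{(K'+1) q}
  set W : ℤ := ((d : ℤ) + 1) ^ 4 * (2 ^ d) ^ 4 * (s * t) ^ (2 * d) with hWdef
  have hWB : ((d : ℤ) + 1) * ((d : ℤ) + 1) * Bnd = W * L := by rw [hBnddef, hWdef]; ring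
  have hst0 : 0 ≤ s * t := mul_nonneg hs0 ht0
  have h2d0 : (0 : ℤ) ≤ (2 ^ d) ^ 4 := by positivity
  have hW0 : 0 ≤ W :=
    mul_nonneg (mul_nonneg (pow_nonneg (by positivity) 4) h2d0) (pow_nonneg hst0 _)
  have hd1 : (d : ℤ) + 1 ≤ 2 ^ d := by exact_mod_cast Nat.lt_two_pow_self
  have hlam2 : (b : ℤ) * c ≤ 2 ^ lam := by
    rw [hlamdef]; exact_mod_cast (Nat.lt_two_pow_self (n := b * c)).le
  have hst : s * t ≤ 2 ^ (lam * N') := by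
    rw [hsdef, htdef, ← mul_pow, pow_mul]
    exact pow_le_pow_left₀ (by positivity) hlam2 N'
  have hWle : W ≤ 2 ^ (8 * d + 2 * d * (lam * N')) := by
    have h1 : ((d : ℤ) + 1) ^ 4 ≤ (2 ^ d) ^ 4 := pow_le_pow_left₀ (by positivity) hd1 4
    have h2 : (s * t) ^ (2 * d) ≤ (2 ^ (lam * N')) ^ (2 * d) := pow_le_pow_left₀ hst0 hst _
    calc W = ((d : ℤ) + 1) ^ 4 * (2 ^ d) ^ 4 * (s * t) ^ (2 * d) := hWdef
      _ ≤ (2 ^ d) ^ 4 * (2 ^ d) ^ 4 * (2 ^ (lam * N')) ^ (2 * d) :=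
          mul_le_mul (mul_le_mul_of_nonneg_right h1 h2d0) h2 (pow_nonneg hst0 _) (by positivity)
      _ = 2 ^ (8 * d + 2 * d * (lam * N')) := by
          rw [← pow_mul, ← pow_mul, ← pow_add, ← pow_add]
          congr 1
          ring
  have hLsq : L ^ 2 ≤ (2 : ℤ) ^ ((K' + 1) * q) := by
    have h1 : (L ^ 2) ^ m ≤ ((2 : ℤ) ^ ((K' + 1) * q)) ^ m := by
      rw [← pow_mul, ← pow_mul, show (K' + 1) * q * m = (K' + 1)! by
        rw [Nat.factorial_succ, ← hN'def, hq]; ring]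
      rw [hmdef, hlamdef]
      rw [hmdef, hlamdef] at hL
      exact hL
    exact (pow_le_pow_iff_left₀ (by positivity) (by positivity) hm0).mp h1
  have hsq : (2 : ℤ) ^ (2 * (K' * q)) ≤ 2 ^ (2 * (8 * d + 2 * d * (lam * N'))) * 2 ^ ((K' + 1) * q) := by
    calc (2 : ℤ) ^ (2 * (K' * q)) = (2 ^ (K' * q)) ^ 2 := by rw [pow_mul']
      _ ≤ (W * L) ^ 2 := pow_le_pow_left₀ (by positivity) (hdom2.trans (le_of_eq hWB)) 2
      _ = W ^ 2 * L ^ 2 := by ring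
      _ ≤ W ^ 2 * 2 ^ ((K' + 1) * q) := mul_le_mul_of_nonneg_left hLsq (by positivity)
      _ ≤ (2 ^ (8 * d + 2 * d * (lam * N'))) ^ 2 * 2 ^ ((K' + 1) * q) :=
          mul_le_mul_of_nonneg_right (pow_le_pow_left₀ hW0 hWle 2) (by positivity)
      _ = 2 ^ (2 * (8 * d + 2 * d * (lam * N'))) * 2 ^ ((K' + 1) * q) := by
          rw [← pow_mul' (2 : ℤ) 2 (8 * d + 2 * d * (lam * N'))]
  rw [← pow_add] at hsq
  have hexp : 2 * (K' * q) ≤ 2 * (8 * d + 2 * d * (lam * N')) + (K' + 1) * q :=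
    (pow_le_pow_iff_right₀ (by norm_num : (1 : ℤ) < 2)).mp hsq
  -- contradiction with K' + 1 ≥ 12 lam m (d+1), N' = m q, lam ≥ 4
  rw [hq] at hexp
  exact final_count_gen hK hm1 hq1 hlam4 hexp

/-- **(T) is the `(3, 2)` INSTANCE of (T_gen)** — the multiplicative-independence hypothesis DISCHARGED by
`mulIndep_three_two` (unique factorisation); thresholds `12·6^{d+1}(d+1) ≤ K`, `L^{2·6^d} ≤ 2^{K!}`
(the direct proof `onePoint_nonvanishing` above has the sharper `6^{d+2}(d+1) ≤ K`). -/
theorem onePoint_nonvanishing_three_two (F : ℤ[X][X]) (hF : F ≠ 0) {d K : ℕ} {L : ℤ}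
    (hdegy : F.natDegree ≤ d) (hdegx : ∀ i, (F.coeff i).natDegree ≤ d)
    (hcoef : ∀ i j, |(F.coeff i).coeff j| ≤ L)
    (hK : 12 * 6 ^ (d + 1) * (d + 1) ≤ K) (hL : L ^ (2 * 6 ^ d) ≤ (2 : ℤ) ^ K !) :
    evxy (psQ 3 K) (psQ 2 K) F ≠ 0 :=
  onePoint_nonvanishing_general (b := 3) (c := 2) (by norm_num) (by norm_num) mulIndep_three_two F hF
    hdegy hdegx hcoef (by norm_num; exact hK) (by norm_num; exact hL)

/-- **The `(2, 3)` instance** (`x ↔ y` swapped: the point `(s²_K, s³_K)`), also hypothesis-free. -/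
theorem onePoint_nonvanishing_two_three (F : ℤ[X][X]) (hF : F ≠ 0) {d K : ℕ} {L : ℤ}
    (hdegy : F.natDegree ≤ d) (hdegx : ∀ i, (F.coeff i).natDegree ≤ d)
    (hcoef : ∀ i j, |(F.coeff i).coeff j| ≤ L)
    (hK : 12 * 6 ^ (d + 1) * (d + 1) ≤ K) (hL : L ^ (2 * 6 ^ d) ≤ (2 : ℤ) ^ K !) :
    evxy (psQ 2 K) (psQ 3 K) F ≠ 0 :=
  onePoint_nonvanishing_general (b := 2) (c := 3) (by norm_num) (by norm_num) mulIndep_two_three F hF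
    hdegy hdegx hcoef (by norm_num; exact hK) (by norm_num; exact hL)

end OnePoint

end Summit.Schanuel.Schanuel.Theorems.RootDecomp1KOnePointCell
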